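import Mathlib
import Summits.Ventures.FusionMHD.Models.CerfonFreidbergIterLikeAxis
import Literature.MathematicalPhysics.MHD.MercierNearAxisEquilibriumRelation
import HarnessLib

/-!
# Ventures/FusionMHD — Models/CerfonFreidbergIterLikeAxisShape.lean: the near-axis SHAPE of the Cerfon–Freidberg
# ITER-like instance of record — Bateman's (7.3.5) holds EXACTLY (from the Grad–Shafranov jets), the mixed jet
# `U_XYY`, the jet-triangularity `Δ`, and the Freidberg (12.89) parameters `(κ₀, δ/ε = κ₀Δ, β_p0 = 1)` in the kernel

HONEST FRAMING (LADDER-GRIDFUSION three columns; rung F1.MER-axis on the CF «computed-shape» rung; F2 row B2).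
`U` = THE flux function of record of the CF ITER-like instance (`CerfonFreidbergIterLikeAxisCert.U`), `X_a` its axis.
Row B2 of bench/F2-CF-ITER-truth-lineage1.json (VALIDATED) carried «(7.3.5) residual ∋ 0» — Bateman's near-axis
EQUILIBRIUM RELATION `Δ = 1/(2e) − Q(e + 1/e) + (d/2)(e + 1/(3e))` checked numerically on the jets.  THIS FILE makes it
a THEOREM: by `Literature/…/MercierNearAxisEquilibriumRelation.lean` (model-5 g5: (7.3.5) at `Q = 0` IS the third-order
content of the GS equation at the axis) and the closed-form GS identities of `CerfonFreidbergAlphaZeroDerivatives`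
(`gs_expanded_cfSolution_zero`, `gs_deriv_cfSolution_zero`), for the instance of record:
* `gs_axis` — `U_XX + U_YY = X_a²` at the axis; `dRZZ_axis_eq` — `U_XYY = 2X_a − U_XXX + U_XX/X_a`,
  `U_XYY(X_a,0) ∈ [0.8047727, 0.8047729]`;
* **`nearAxisTriangularity_eq_triangularity`** — `Δ_jet := X_aU_XYY/(2κ₀U_YY) + S/κ₀ = triangularity κ₀ 0 d` EXACTLY
  (`d = nearAxisD U X_a`), and `Δ ∈ [0.5676461, 0.5676462]` (PCF instances: `Δ = 1/(2κ₀)` exactly, `d = 0`);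
* **Freidberg (12.89) form** (lit-3 p504651 `bound_one_eq_shapedBound`): the CF axis sits at Freidberg parameters
  `(κ, δ/ε, β_p0) = (κ₀, κ₀Δ, 1)` with `κ₀Δ = 1/2 + (d/2)(κ₀² + 1/3) ∈ [0.9006132, 0.9006133]` (PCF: `1/2`), and
  `mercierNearAxis_iff_shapedAxisCriterion_U` — Bateman's near-axis Mercier criterion on the instance ⟺ Freidberg's
  `ShapedAxisCriterion (q₀ F) κ₀ (κ₀Δ) 1`: the CF near-axis Mercier row (`CerfonFreidbergIterLikeAxis`, F_M⁺ = 0.5583)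
  is now the threshold of TWO printed criteria of independent lineage.
MODELLED: analytic CF family; near-axis expansion; necessary criterion only; no stability claim.
Typer/prover: gridfusion-model-5 (g5), 2026-08-27.  Citations: Bateman 1978 §7.3 (7.3.3)–(7.3.5) [Bateman1978];
Freidberg 2014 §12.5.4 (12.89) [Freidberg2014].
-/

noncomputable section

open Set
open Literature.MathematicalPhysics.MHD Literature.MathematicalPhysics.MHD.GradShafranov
  Literature.MathematicalPhysics.MHD.FluxGeometry Literature.MathematicalPhysics.MHD.CerfonFreidberg
  Literature.MathematicalPhysics.MHD.Mercier.NearAxis _root_.Real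
open Summit.Ventures.FusionMHD.Models.SolovevPCF (nearAxisShift nearAxisD nearAxisTriangularity)

namespace Summit.Ventures.FusionMHD.Models.CFIterLike

/-! ## §1 The Grad–Shafranov jets at the axis -/

/-- **GS at the axis:** `U_XX(X_a,0) + U_YY(X_a,0) = X_a²` (`Δ*U = X²` with `U_X = 0`). -/
theorem gs_axis : dRR U Xa 0 + dZZ U Xa 0 = Xa ^ 2 := by
  have h := gs_expanded_cfSolution_zero coeff Xa_pos.ne' 0
  have h0 : dR (cfSolution 0 coeff) Xa 0 = 0 := axis.1
  rw [h0, zero_div, sub_zero] at h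
  exact h

/-- **The mixed cubic jet from the differentiated GS equation:** `U_XYY(X_a,0) = 2X_a − U_XXX(X_a,0) + U_XX(X_a,0)/X_a`. -/
theorem dRZZ_axis_eq : dRZZ U Xa 0 = 2 * Xa - dRRR U Xa 0 + dRR U Xa 0 / Xa := by
  have h := gs_deriv_cfSolution_zero coeff Xa_pos.ne' 0
  have h0 : dR (cfSolution 0 coeff) Xa 0 = 0 := axis.1
  rw [h0, zero_div, add_zero] at h
  have e1 : dRZZ U Xa 0 = deriv (fun r => dZZ (cfSolution 0 coeff) r 0) Xa := rfl
  have e2 : dRRR U Xa 0 = iteratedDeriv 3 (fun r => cfSolution 0 coeff r 0) Xa := rfl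
  rw [e1, e2]
  have e3 : dRR U Xa 0 = dRR (cfSolution 0 coeff) Xa 0 := rfl
  rw [e3]
  linarith

/-- `U_XYY(X_a,0) ∈ [0.8047727, 0.8047729]`. -/
theorem dRZZ_axis_bounds : (8047727 / 10000000 : ℝ) ≤ dRZZ U Xa 0 ∧ dRZZ U Xa 0 ≤ 8047729 / 10000000 := by
  rw [dRZZ_axis_eq]
  obtain ⟨hX1, hX2⟩ := Xa_bounds
  obtain ⟨ha1, ha2⟩ := dRR_axis_bounds
  obtain ⟨ht1, ht2⟩ := dRRR_axis_bounds
  have hX := Xa_pos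
  have hlo : (78220322 / 100000000 : ℝ) / (104543965 / 100000000) ≤ dRR U Xa 0 / Xa :=
    div_le_div₀ (by linarith) ha1 hX hX2
  have hhi : dRR U Xa 0 / Xa ≤ (78220323 / 100000000 : ℝ) / (104543964 / 100000000) :=
    div_le_div₀ (by norm_num) ha2 (by norm_num) hX1
  constructor
  · have : (8047727 / 10000000 : ℝ) ≤ 2 * (104543964 / 100000000) - 203431155 / 100000000
        + (78220322 / 100000000 : ℝ) / (104543965 / 100000000) := by norm_num
    linarith
  · have : 2 * (104543965 / 100000000 : ℝ) - 203431154 / 100000000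
        + (78220323 / 100000000 : ℝ) / (104543964 / 100000000) ≤ 8047729 / 10000000 := by norm_num
    linarith

/-! ## §2 Bateman's (7.3.5) holds exactly; the jet-triangularity -/

/-- **Bateman's equilibrium relation (7.3.5) holds EXACTLY on the instance of record** (`Q = 0`): the jet-triangularity
`Δ_jet = X_aU_XYY/(2κ₀U_YY) + S/κ₀` equals `triangularity κ₀ 0 d` with `d = nearAxisD U X_a` — by the GS jets alone
(`MercierNearAxisEquilibriumRelation.jetTriangularity_eq_triangularity`). -/
theorem nearAxisTriangularity_eq_triangularity :
    nearAxisTriangularity U Xa (elongationOnAxis (dRR U Xa 0) (dZZ U Xa 0))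
      = triangularity (elongationOnAxis (dRR U Xa 0) (dZZ U Xa 0)) 0 (nearAxisD U Xa) := by
  obtain ⟨hxx, hyy⟩ := hessian_axis_pos
  have he : 0 < elongationOnAxis (dRR U Xa 0) (dZZ U Xa 0) := by linarith [elongationOnAxis_bounds.1]
  have hE : elongationOnAxis (dRR U Xa 0) (dZZ U Xa 0) ^ 2 = dRR U Xa 0 / dZZ U Xa 0 := by
    unfold elongationOnAxis
    rw [Real.sq_sqrt (div_pos hxx hyy).le]
  have hGS : dRR U Xa 0 + dZZ U Xa 0 = 1 * Xa ^ 2 := by rw [one_mul]; exact gs_axis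
  have hGS' : dRRR U Xa 0 - dRR U Xa 0 / Xa + dRZZ U Xa 0 = 2 * 1 * Xa := by
    rw [dRZZ_axis_eq]; ring
  unfold nearAxisTriangularity nearAxisD nearAxisShift
  exact jetTriangularity_eq_triangularity hxx.ne' hyy.ne' Xa_pos.ne' he.ne' hE hGS hGS'

/-- `κ₀·Δ = 1/2 + (d/2)(κ₀² + 1/3)` (the product that is Freidberg's `δ/ε`). -/
theorem elongation_mul_triangularity_eq :
    elongationOnAxis (dRR U Xa 0) (dZZ U Xa 0)
        * nearAxisTriangularity U Xa (elongationOnAxis (dRR U Xa 0) (dZZ U Xa 0))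
      = 1 / 2 + nearAxisD U Xa / 2 * (elongationOnAxis (dRR U Xa 0) (dZZ U Xa 0) ^ 2 + 1 / 3) := by
  rw [nearAxisTriangularity_eq_triangularity]
  have he : 0 < elongationOnAxis (dRR U Xa 0) (dZZ U Xa 0) := by linarith [elongationOnAxis_bounds.1]
  unfold triangularity
  field_simp
  ring

/-- **`κ₀Δ ∈ [0.9006132, 0.9006133]`** (PCF instances: `1/2` exactly). -/
theorem elongation_mul_triangularity_bounds :
    (9006132 / 10000000 : ℝ) ≤ elongationOnAxis (dRR U Xa 0) (dZZ U Xa 0)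
        * nearAxisTriangularity U Xa (elongationOnAxis (dRR U Xa 0) (dZZ U Xa 0))
    ∧ elongationOnAxis (dRR U Xa 0) (dZZ U Xa 0)
        * nearAxisTriangularity U Xa (elongationOnAxis (dRR U Xa 0) (dZZ U Xa 0)) ≤ 9006133 / 10000000 := by
  rw [elongation_mul_triangularity_eq]
  obtain ⟨hk1, hk2⟩ := elongationOnAxis_bounds
  obtain ⟨hd1, hd2⟩ := nearAxisD_bounds
  set k := elongationOnAxis (dRR U Xa 0) (dZZ U Xa 0)
  set d := nearAxisD U Xa
  have hk0 : 0 ≤ k := by linarith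
  have hsq1 : (158657511 / 100000000 : ℝ) ^ 2 ≤ k ^ 2 := pow_le_pow_left₀ (by norm_num) hk1 2
  have hsq2 : k ^ 2 ≤ (158657512 / 100000000 : ℝ) ^ 2 := pow_le_pow_left₀ hk0 hk2 2
  constructor <;> nlinarith

/-- **`Δ ∈ [0.5676461, 0.5676462]`** — the jet-triangularity of the CF ITER-like axis (row B2: `0.56764617…`). -/
theorem nearAxisTriangularity_bounds :
    (5676461 / 10000000 : ℝ) ≤ nearAxisTriangularity U Xa (elongationOnAxis (dRR U Xa 0) (dZZ U Xa 0))
    ∧ nearAxisTriangularity U Xa (elongationOnAxis (dRR U Xa 0) (dZZ U Xa 0)) ≤ 5676462 / 10000000 := by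
  obtain ⟨h1, h2⟩ := elongation_mul_triangularity_bounds
  obtain ⟨hk1, hk2⟩ := elongationOnAxis_bounds
  set k := elongationOnAxis (dRR U Xa 0) (dZZ U Xa 0)
  set T := nearAxisTriangularity U Xa k
  have hk : 0 < k := by linarith
  constructor
  · -- k*T ≥ lo and k ≤ khi ⇒ T ≥ lo/khi ≥ 0.5676461
    by_contra hT
    push Not at hT
    have : k * T < (158657512 / 100000000 : ℝ) * (5676461 / 10000000) := by nlinarith
    nlinarith
  · by_contra hT
    push Not at hT
    have : (158657511 / 100000000 : ℝ) * (5676462 / 10000000) < k * T := by nlinarith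
    nlinarith

/-! ## §3 Freidberg's shaped on-axis Mercier criterion (12.89) on the instance (second printed lineage) -/

/-- **Bateman ⟺ Freidberg on the CF axis:** for every `F ≠ 0`, Bateman's near-axis Mercier criterion on the instance of
record is Freidberg's shaped on-axis criterion (12.89) at `(κ, δ/ε, β_p0) = (κ₀, κ₀Δ, 1)` with `Δ` the JET-triangularity
(lit-3's identity `bound_one_eq_shapedBound` + `nearAxisTriangularity_eq_triangularity`). -/
theorem mercierNearAxis_iff_shapedAxisCriterion_U {F : ℝ} (hF : F ≠ 0) :
    MercierCriterion (safetyFactorOnAxis F Xa (dRR U Xa 0) (dZZ U Xa 0))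
        (elongationOnAxis (dRR U Xa 0) (dZZ U Xa 0)) 0 (nearAxisD U Xa)
      ↔ ShapedAxisCriterion (safetyFactorOnAxis F Xa (dRR U Xa 0) (dZZ U Xa 0))
          (elongationOnAxis (dRR U Xa 0) (dZZ U Xa 0))
          (elongationOnAxis (dRR U Xa 0) (dZZ U Xa 0)
            * nearAxisTriangularity U Xa (elongationOnAxis (dRR U Xa 0) (dZZ U Xa 0))) 1 := by
  have he : 0 < elongationOnAxis (dRR U Xa 0) (dZZ U Xa 0) := by linarith [elongationOnAxis_bounds.1]
  have hq : safetyFactorOnAxis F Xa (dRR U Xa 0) (dZZ U Xa 0) ≠ 0 := by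
    intro h0
    have h2 := q0_sq F
    rw [h0] at h2
    have hr : 0 < q0SqOverFSq := by linarith [q0SqOverFSq_bounds.1]
    have : 0 < F ^ 2 * q0SqOverFSq := by positivity
    simp at h2
    rcases h2 with h | h
    · exact hF h
    · linarith
  rw [mercierCriterion_iff_shapedAxisCriterion hq he, nearAxisTriangularity_eq_triangularity]
  norm_num

/-- Hence the CERTIFIED near-axis Mercier thresholds of `CerfonFreidbergIterLikeAxis` are thresholds of Freidberg's
(12.89) as well: `∀ F ≥ 0.5583`, `ShapedAxisCriterion (q₀ F) κ₀ (κ₀Δ) 1`. -/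
theorem shapedAxisCriterion_of_le {F : ℝ} (hF : FmercierAxis ≤ F) :
    ShapedAxisCriterion (safetyFactorOnAxis F Xa (dRR U Xa 0) (dZZ U Xa 0))
      (elongationOnAxis (dRR U Xa 0) (dZZ U Xa 0))
      (elongationOnAxis (dRR U Xa 0) (dZZ U Xa 0)
        * nearAxisTriangularity U Xa (elongationOnAxis (dRR U Xa 0) (dZZ U Xa 0))) 1 := by
  have hF0 : 0 < F := lt_of_lt_of_le (by unfold FmercierAxis; norm_num) hF
  exact (mercierNearAxis_iff_shapedAxisCriterion_U hF0.ne').mp (mercierNearAxis_of_le hF)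

/-- … and `∀ 0 < F ≤ 0.5582`, `¬ ShapedAxisCriterion (q₀ F) κ₀ (κ₀Δ) 1`. -/
theorem not_shapedAxisCriterion_of_le {F : ℝ} (hF0 : 0 < F) (hF : F ≤ 2791 / 5000) :
    ¬ ShapedAxisCriterion (safetyFactorOnAxis F Xa (dRR U Xa 0) (dZZ U Xa 0))
      (elongationOnAxis (dRR U Xa 0) (dZZ U Xa 0))
      (elongationOnAxis (dRR U Xa 0) (dZZ U Xa 0)
        * nearAxisTriangularity U Xa (elongationOnAxis (dRR U Xa 0) (dZZ U Xa 0))) 1 := by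
  rw [← mercierNearAxis_iff_shapedAxisCriterion_U hF0.ne']
  exact not_mercierNearAxis_of_le hF0 hF

end Summit.Ventures.FusionMHD.Models.CFIterLike
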